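import Summits.SmoothPoincare4.SmoothPoincare4.Theorems.SymplecticOrigamiOrigamiFoldExistenceShadowPleatsCleanDefs
import Summits.SmoothPoincare4.SmoothPoincare4.Theorems.SymplecticOrigamiOrigamiFoldExistenceStubPleatFreeStandardSheets
import Mathlib.Analysis.Calculus.Deriv.Comp
import Mathlib.Analysis.Calculus.FDeriv.CompCLM
import Mathlib.Analysis.SpecialFunctions.Trigonometric.Deriv
import Mathlib.Topology.Algebra.Module.FiniteDimension

/-!
# Stub `stub_cleanOnePleatIroning` of line `shadow-pleats` for crux `OrigamiFoldExistence` — IV: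
# the kernel of a Whitney fold is transverse to the fold sphere (item stmt-SmoothPoincare4-7844, route SymplecticOrigami; seat c3, S5a worker)

Fourth helper file for the registered stub `stub_cleanOnePleatIroning` (S5a), first step of the
SMOOTH HALF of its remaining ingredient `CleanPleatIroningChart` (file III): the radial family of
spheres `r ↦ proj5 ι e(S_r)`, `0 < r ≤ R`, of a clean pleat chart is an isotopy through EMBEDDED
`3`-spheres, also at the two fold radii `r = 1, 2` — because at a Whitney fold point the kernel
of the shadow differential is TRANSVERSE to the fold locus, so the crease maps `proj5 ι e|S₁`,
`proj5 ι e|S₂` are immersions (and injective by cleanness).  This is also the standing assumption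
"creases are immersed `S³ ↬ ℝ⁴`" of seat c2's sheet bookkeeping (W-Morse-analysis-c2 §4).

* `inner_ne_zero_of_isFoldPoint` — **fold kernels are transverse** (determinant-free proof): let
  `G : ℝ⁴ → ℝ⁴` be smooth, `u ≠ 0`, `v ≠ 0` a kernel vector of `dG(u)` spanning the kernel, with
  the fold condition `D²G(u)[v,v] ∉ range dG(u)` of `IsFoldPointAt`, and suppose `dG` is singular
  at every point of the round sphere through `u`.  Then `⟪u, v⟫ ≠ 0`.  (If `v ⊥ u`, follow the
  great circle `γ` through `u` with velocity `v`; unit kernel vectors `kₙ` of `dG(γ(sₙ))`,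
  `sₙ → 0`, subconverge to a unit kernel vector `k₀ = c v` of `dG(u)`; dividing
  `0 = dG(γ sₙ) kₙ = dG(u) kₙ + sₙ D²G(u)[v, kₙ] + o(sₙ)` by `sₙ` exhibits `c D²G(u)[v,v]` as a
  limit of points of the closed subspace `range dG(u)` — contradiction.)
* `exists_eq_smul_of_fderiv_shadow_eq_zero` — the kernel of the shadow differential
  `d(proj5 ∘ L)(u)` of an immersion `L : ℝ⁴ → ℝ⁵` is a line (a kernel vector lifts to a vertical
  vector).
* `eq_zero_of_fderiv_chartShadow_eq_zero` — **the creases of a pleated position are immersed**: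
  for a pleat chart `e j` of `IsPleatedPosition ι δ e` and `u` on a fold sphere, a tangent vector
  `w ⊥ u` of the sphere killed by `d(proj5 ∘ ι ∘ e j)(u)` is zero.

Sources: M. Golubitsky, V. Guillemin, *Stable mappings and their singularities* (1973), Ch. III
§4 (folds: `j¹f ⋔ S₁` and kernel transverse to the singular set); Disproof.lean §7c; c2 §4.
-/

noncomputable section

-- the prescribed namespace `Summit.<P>.<Sub>.…` duplicates `SmoothPoincare4` (P = Sub)
set_option linter.dupNamespace false

open scoped Manifold ContDiff Topology RealInnerProductSpace
open Set Function Filter Metric Asymptotics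

namespace Summit.SmoothPoincare4.SmoothPoincare4.Theorems.OrigamiFoldExistence.ShadowPleats

/-! ### Fold kernels are transverse to the singular sphere -/

section FoldKernel

/-- **The kernel of a Whitney fold is transverse to the fold sphere.**  `G : ℝ⁴ → ℝ⁴` smooth,
`u ≠ 0`; `v ≠ 0` spans `ker dG(u)` and satisfies the fold condition of `IsFoldPointAt`
(`D²G(u)[v,v] ∉ range dG(u)`); `dG` is singular along the round sphere through `u`.  Then `v` is
not tangent to that sphere: `⟪u, v⟫ ≠ 0`. [folklore] -/
theorem inner_ne_zero_of_isFoldPoint {G : EuclideanSpace ℝ (Fin 4) → EuclideanSpace ℝ (Fin 4)}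
    (hG : ContDiff ℝ ∞ G) {u v : EuclideanSpace ℝ (Fin 4)} (hu : u ≠ 0) (hv : v ≠ 0)
    (hfold : fderiv ℝ (fun w => fderiv ℝ G w v) u v ∉ LinearMap.range (fderiv ℝ G u).toLinearMap)
    (hline : ∀ w, fderiv ℝ G u w = 0 → ∃ c : ℝ, w = c • v)
    (hsing : ∀ w : EuclideanSpace ℝ (Fin 4), ‖w‖ = ‖u‖ →
      ∃ k : EuclideanSpace ℝ (Fin 4), k ≠ 0 ∧ fderiv ℝ G w k = 0) :
    ⟪u, v⟫ ≠ 0 := by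
  intro h0
  have hupos : 0 < ‖u‖ := norm_pos_iff.2 hu
  have hvpos : 0 < ‖v‖ := norm_pos_iff.2 hv
  -- the great circle through `u` with velocity `v`
  set a : ℝ := ‖v‖ / ‖u‖ with ha
  set b : ℝ := ‖u‖ / ‖v‖ with hb
  have hba : b * a = 1 := by
    rw [ha, hb]; field_simp
  set γ : ℝ → EuclideanSpace ℝ (Fin 4) :=
    fun t => Real.cos (a * t) • u + (b * Real.sin (a * t)) • v with hγ
  have hγ0 : γ 0 = u := by simp [hγ]
  have hγnorm : ∀ t, ‖γ t‖ = ‖u‖ := by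
    intro t
    have hsq : ‖γ t‖ ^ 2 = ‖u‖ ^ 2 := by
      have h1 : ‖γ t‖ ^ 2 = ‖Real.cos (a * t) • u‖ ^ 2 +
          2 * ⟪Real.cos (a * t) • u, (b * Real.sin (a * t)) • v⟫ +
          ‖(b * Real.sin (a * t)) • v‖ ^ 2 := by
        rw [hγ]
        exact norm_add_sq_real _ _
      rw [h1, real_inner_smul_left, real_inner_smul_right, h0, mul_zero, mul_zero, mul_zero,
        add_zero, norm_smul, norm_smul, mul_pow, mul_pow, Real.norm_eq_abs, Real.norm_eq_abs,
        sq_abs, sq_abs, hb, mul_pow, div_pow]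
      have hv2 : ‖v‖ ^ 2 ≠ 0 := by positivity
      field_simp
      nlinarith [Real.cos_sq_add_sin_sq (a * t)]
    have := (sq_eq_sq₀ (norm_nonneg _) (norm_nonneg _)).1 hsq
    exact this
  have hγderiv : HasDerivAt γ v 0 := by
    have hlin : HasDerivAt (fun t : ℝ => a * t) a 0 := by
      simpa using (hasDerivAt_id (0 : ℝ)).const_mul a
    have h1 : HasDerivAt (fun t : ℝ => Real.cos (a * t)) (-Real.sin (a * 0) * a) 0 :=
      (Real.hasDerivAt_cos (a * 0)).comp (0 : ℝ) hlin
    have h2 : HasDerivAt (fun t : ℝ => b * Real.sin (a * t)) (b * (Real.cos (a * 0) * a)) 0 :=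
      ((Real.hasDerivAt_sin (a * 0)).comp (0 : ℝ) hlin).const_mul b
    have h3 := (h1.smul_const u).add (h2.smul_const v)
    have heq : (-Real.sin (a * 0) * a) • u + (b * (Real.cos (a * 0) * a)) • v = v := by
      simp only [mul_zero, Real.sin_zero, neg_zero, zero_mul, zero_smul, Real.cos_zero, one_mul,
        zero_add, hba, one_smul]
    rw [heq] at h3
    exact h3
  -- unit kernel vectors along the circle, at times `1/(n+1)`
  have hk : ∀ n : ℕ, ∃ k : EuclideanSpace ℝ (Fin 4), ‖k‖ = 1 ∧
      fderiv ℝ G (γ (1 / ((n : ℝ) + 1))) k = 0 := by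
    intro n
    obtain ⟨k, hk0, hk⟩ := hsing _ (hγnorm _)
    refine ⟨‖k‖⁻¹ • k, ?_, ?_⟩
    · rw [norm_smul, norm_inv, norm_norm, inv_mul_cancel₀ (norm_ne_zero_iff.2 hk0)]
    · rw [map_smul, hk, smul_zero]
  choose k hk1 hk2 using hk
  obtain ⟨k₀, hk₀S, φ, hφ, hlim⟩ :=
    (isCompact_sphere (0 : EuclideanSpace ℝ (Fin 4)) 1).tendsto_subseq (x := k)
      (fun n => mem_sphere_zero_iff_norm.2 (hk1 n))
  have hk₀1 : ‖k₀‖ = 1 := mem_sphere_zero_iff_norm.1 hk₀S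
  -- the times along the subsequence
  set s : ℕ → ℝ := fun n => 1 / ((φ n : ℝ) + 1) with hs
  have hspos : ∀ n, 0 < s n := fun n => by positivity
  have hs0 : Tendsto s atTop (𝓝 0) :=
    (tendsto_one_div_add_atTop_nhds_zero_nat).comp hφ.tendsto_atTop
  have hks : ∀ n, fderiv ℝ G (γ (s n)) (k (φ n)) = 0 := fun n => hk2 (φ n)
  -- `dG(u) k₀ = 0`, by continuity of `dG` and of evaluation
  have hdGcont : Continuous (fderiv ℝ G) := hG.continuous_fderiv (by simp)
  have hγcont : Continuous γ := by
    rw [hγ]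
    fun_prop
  have hT : Tendsto (fun n => fderiv ℝ G (γ (s n))) atTop (𝓝 (fderiv ℝ G u)) := by
    have : Tendsto (fun n => γ (s n)) atTop (𝓝 (γ 0)) := (hγcont.tendsto 0).comp hs0
    rw [hγ0] at this
    exact (hdGcont.tendsto u).comp this
  have hk₀ker : fderiv ℝ G u k₀ = 0 := by
    have hev : Continuous fun p : (EuclideanSpace ℝ (Fin 4) →L[ℝ] EuclideanSpace ℝ (Fin 4)) ×
        EuclideanSpace ℝ (Fin 4) => p.1 p.2 :=
      isBoundedBilinearMap_apply.continuous
    have h1 : Tendsto (fun n => fderiv ℝ G (γ (s n)) (k (φ n))) atTop (𝓝 (fderiv ℝ G u k₀)) :=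
      (hev.tendsto _).comp (hT.prodMk_nhds hlim)
    simp only [hks] at h1
    exact (tendsto_nhds_unique tendsto_const_nhds h1).symm
  obtain ⟨c, hc⟩ := hline k₀ hk₀ker
  have hc0 : c ≠ 0 := by
    rintro rfl
    rw [zero_smul] at hc
    rw [hc, norm_zero] at hk₀1
    exact zero_ne_one hk₀1
  -- the derivative of `t ↦ dG(γ t)` at `0` is `A = D(dG)(u)[v]`
  set A : EuclideanSpace ℝ (Fin 4) →L[ℝ] EuclideanSpace ℝ (Fin 4) := fderiv ℝ (fderiv ℝ G) u v
    with hA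
  have hdG1 : ContDiff ℝ ∞ (fderiv ℝ G) := (contDiff_infty_iff_fderiv.1 hG).2
  have hdiff : DifferentiableAt ℝ (fderiv ℝ G) u := (hdG1.differentiable (by simp)) u
  have hΦ : HasDerivAt (fun t => fderiv ℝ G (γ t)) A 0 := by
    have h1 : HasFDerivAt (fderiv ℝ G) (fderiv ℝ (fderiv ℝ G) u) (γ 0) := by
      rw [hγ0]; exact hdiff.hasFDerivAt
    exact h1.comp_hasDerivAt (0 : ℝ) hγderiv
  -- the fold quantity is `A v`
  have hfoldA : fderiv ℝ (fun w => fderiv ℝ G w v) u v = A v := by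
    rw [fderiv_clm_apply hdiff (differentiableAt_const v), fderiv_fun_const]
    simp [hA]
  -- little-o: `(s n)⁻¹ • (dG(γ (s n)) - dG(u) - s n • A) → 0`
  have ho := hΦ.isLittleO
  have hE : Tendsto (fun n => (s n)⁻¹ • (fderiv ℝ G (γ (s n)) - fderiv ℝ G u - (s n) • A))
      atTop (𝓝 0) := by
    rw [Metric.tendsto_atTop]
    intro ε hε
    have h2 := hs0.eventually (ho.def (half_pos hε))
    obtain ⟨N, hN⟩ := eventually_atTop.1 h2
    refine ⟨N, fun n hn => ?_⟩
    have h3 := hN n hn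
    simp only [sub_zero, hγ0] at h3
    rw [dist_zero_right, norm_smul, norm_inv, Real.norm_eq_abs, abs_of_pos (hspos n)]
    rw [Real.norm_eq_abs, abs_of_pos (hspos n)] at h3
    calc (s n)⁻¹ * ‖fderiv ℝ G (γ (s n)) - fderiv ℝ G u - s n • A‖
        ≤ (s n)⁻¹ * (ε / 2 * s n) := by gcongr
      _ = ε / 2 := by rw [mul_comm, mul_assoc, mul_inv_cancel₀ (hspos n).ne', mul_one]
      _ < ε := half_lt_self hε
  -- evaluate at the unit vectors `k (φ n)`
  have hE' : Tendsto (fun n => ((s n)⁻¹ • (fderiv ℝ G (γ (s n)) - fderiv ℝ G u - (s n) • A))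
      (k (φ n))) atTop (𝓝 0) := by
    refine squeeze_zero_norm (fun n => ?_) (by simpa using hE.norm)
    calc ‖((s n)⁻¹ • (fderiv ℝ G (γ (s n)) - fderiv ℝ G u - (s n) • A)) (k (φ n))‖
        ≤ ‖(s n)⁻¹ • (fderiv ℝ G (γ (s n)) - fderiv ℝ G u - (s n) • A)‖ * ‖k (φ n)‖ :=
          ContinuousLinearMap.le_opNorm _ _
      _ = ‖(s n)⁻¹ • (fderiv ℝ G (γ (s n)) - fderiv ℝ G u - (s n) • A)‖ := by
          rw [hk1, mul_one]
  have hAk : Tendsto (fun n => A (k (φ n))) atTop (𝓝 (A k₀)) := (A.continuous.tendsto k₀).comp hlim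
  have hid : ∀ n, ((s n)⁻¹ • (fderiv ℝ G (γ (s n)) - fderiv ℝ G u - (s n) • A)) (k (φ n)) +
      A (k (φ n)) = fderiv ℝ G u (-(s n)⁻¹ • k (φ n)) := by
    intro n
    have e1 : ((s n)⁻¹ • (fderiv ℝ G (γ (s n)) - fderiv ℝ G u - (s n) • A)) (k (φ n)) =
        (s n)⁻¹ • (fderiv ℝ G (γ (s n)) (k (φ n)) - fderiv ℝ G u (k (φ n)) -
          (s n) • A (k (φ n))) := rfl
    rw [e1, hks n, map_smul, zero_sub, smul_sub, smul_smul, inv_mul_cancel₀ (hspos n).ne',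
      one_smul, smul_neg, neg_smul]
    abel
  have hr : Tendsto (fun n => fderiv ℝ G u (-(s n)⁻¹ • k (φ n))) atTop (𝓝 (A k₀)) := by
    have := hE'.add hAk
    rw [zero_add] at this
    exact this.congr (fun n => hid n)
  -- the range of `dG(u)` is closed and contains the limit `A k₀ = c • A v`
  have hclosed : IsClosed ((LinearMap.range (fderiv ℝ G u).toLinearMap : Submodule ℝ
      (EuclideanSpace ℝ (Fin 4))) : Set (EuclideanSpace ℝ (Fin 4))) :=
    Submodule.closed_of_finiteDimensional _
  have hmem : A k₀ ∈ LinearMap.range (fderiv ℝ G u).toLinearMap :=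
    hclosed.mem_of_tendsto hr (Eventually.of_forall fun n => ⟨_, rfl⟩)
  apply hfold
  rw [hfoldA]
  have : A v = c⁻¹ • A k₀ := by
    rw [hc, map_smul, smul_smul, inv_mul_cancel₀ hc0, one_smul]
  rw [this]
  exact Submodule.smul_mem _ _ hmem

end FoldKernel

/-! ### The kernel of a hypersurface shadow is a line -/

section KernelLine

/-- A vector of `ℝ⁵` with zero shadow is its height times `e₄`. -/
theorem eq_smul_e4_of_proj5_eq_zero {p : EuclideanSpace ℝ (Fin 5)} (hp : proj5 p = 0) :
    p = (p 4) • e4 := by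
  have := embedL_proj5_add_smul p
  rw [hp, map_zero, zero_add] at this
  exact this.symm

/-- **The kernel of the shadow differential of an immersion `L : ℝ⁴ → ℝ⁵` is at most a line**:
if `v ≠ 0` is killed by `d(proj5 ∘ L)(u)`, every vector killed by it is a multiple of `v`
(both lift under the injective `dL(u)` to vertical vectors). [folklore] -/
theorem exists_eq_smul_of_fderiv_shadow_eq_zero {L : EuclideanSpace ℝ (Fin 4) → EuclideanSpace ℝ (Fin 5)}
    {u : EuclideanSpace ℝ (Fin 4)} (hL : DifferentiableAt ℝ L u) (hLinj : Injective (fderiv ℝ L u))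
    {v : EuclideanSpace ℝ (Fin 4)} (hv : v ≠ 0) (hker : fderiv ℝ (proj5 ∘ L) u v = 0)
    (w : EuclideanSpace ℝ (Fin 4)) (hw : fderiv ℝ (proj5 ∘ L) u w = 0) : ∃ c : ℝ, w = c • v := by
  have hcomp : fderiv ℝ (proj5 ∘ L) u =
      (proj5L : EuclideanSpace ℝ (Fin 5) →L[ℝ] EuclideanSpace ℝ (Fin 4)).comp (fderiv ℝ L u) := by
    rw [← coe_proj5L, fderiv_comp u proj5L.differentiableAt hL, ContinuousLinearMap.fderiv]
  rw [hcomp] at hker hw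
  have hv' : proj5 (fderiv ℝ L u v) = 0 := hker
  have hw' : proj5 (fderiv ℝ L u w) = 0 := hw
  have ev := eq_smul_e4_of_proj5_eq_zero hv'
  have ew := eq_smul_e4_of_proj5_eq_zero hw'
  set p := fderiv ℝ L u v with hp
  set q := fderiv ℝ L u w with hq
  set α : ℝ := p 4 with hα
  set β : ℝ := q 4 with hβ
  have hv4 : α ≠ 0 := by
    intro h
    rw [h, zero_smul] at ev
    exact hv (hLinj (by rw [← hp, ev, map_zero]))
  refine ⟨β / α, hLinj ?_⟩
  rw [map_smul, ← hp, ← hq, ew]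
  conv_rhs => rw [ev]
  rw [smul_smul, div_mul_cancel₀ _ hv4]

end KernelLine

/-! ### The creases of a pleated position are immersed -/

section Creases

variable {M : Type} [TopologicalSpace M] [ChartedSpace (EuclideanSpace ℝ (Fin 4)) M]
  {ι : M → EuclideanSpace ℝ (Fin 5)} {δ : ℝ} {k : ℕ} {e : Fin k → EuclideanSpace ℝ (Fin 4) → M}

/-- A fold sphere point is non-zero and the sphere through it consists of fold sphere points. -/
theorem norm_eq_of_mem_pleatSpheres {u w : EuclideanSpace ℝ (Fin 4)} (hu : u ∈ pleatSpheres)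
    (hw : ‖w‖ = ‖u‖) : w ∈ pleatSpheres := by
  rcases hu with hu | hu
  · rw [mem_sphere_zero_iff_norm] at hu
    exact Or.inl (mem_sphere_zero_iff_norm.2 (hw.trans hu))
  · rw [mem_sphere_zero_iff_norm] at hu
    exact Or.inr (mem_sphere_zero_iff_norm.2 (hw.trans hu))

/-- Fold sphere points are non-zero. -/
theorem ne_zero_of_mem_pleatSpheres {u : EuclideanSpace ℝ (Fin 4)} (hu : u ∈ pleatSpheres) : u ≠ 0 := by
  rintro rfl
  rcases hu with hu | hu <;> simp at hu

/-- The chart map `ι ∘ e j` of a pleated position, between vector spaces, is smooth with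
injective derivative. -/
theorem contDiff_chartMap (h : IsPleatedPosition ι δ e) (j : Fin k) :
    ContDiff ℝ ∞ (ι ∘ e j) ∧ ∀ u, Injective (fderiv ℝ (ι ∘ e j) u) := by
  have hι := h.1
  have he := (h.2.2.2.2.1 j).1
  have hsm : ContMDiff (𝓡 4) (𝓡 5) ∞ (ι ∘ e j) := hι.contMDiff.comp he.contMDiff
  refine ⟨contMDiff_iff_contDiff.1 hsm, fun u => ?_⟩
  have hn : (∞ : WithTop ℕ∞) ≠ 0 := by simp
  have hcomp : mfderiv (𝓡 4) (𝓡 5) (ι ∘ e j) u =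
      (mfderiv (𝓡 4) (𝓡 5) ι (e j u)).comp (mfderiv (𝓡 4) (𝓡 4) (e j) u) :=
    mfderiv_comp u ((hι.contMDiff _).mdifferentiableAt hn) ((he.contMDiff u).mdifferentiableAt hn)
  rw [← mfderiv_eq_fderiv]
  have h1 : Injective (mfderiv (𝓡 4) (𝓡 5) ι (e j u)) := injective_mfderiv_of_emb hι _
  have h2 : Injective (mfderiv (𝓡 4) (𝓡 4) (e j) u) :=
    Literature.Topology.FourManifolds.injective_mfderiv_of_isImmersionAt'
      (he.isImmersion.isImmersionAt u)
  intro a b hab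
  have hab' : (mfderiv (𝓡 4) (𝓡 5) (ι ∘ e j) u) a = (mfderiv (𝓡 4) (𝓡 5) (ι ∘ e j) u) b := hab
  rw [hcomp] at hab'
  exact h2 (h1 hab')

/-- **The creases of a pleated position are immersed**: at a point `u` of a fold sphere of the
chart `e j`, a tangent vector of the sphere (`w ⊥ u`) killed by the shadow differential
`d(proj5 ∘ ι ∘ e j)(u)` vanishes — the fold kernel is transverse to the fold sphere. [folklore] -/
theorem eq_zero_of_fderiv_chartShadow_eq_zero (h : IsPleatedPosition ι δ e) (j : Fin k)
    {u w : EuclideanSpace ℝ (Fin 4)} (hu : u ∈ pleatSpheres) (huw : ⟪u, w⟫ = 0)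
    (hw : fderiv ℝ (proj5 ∘ ι ∘ e j) u w = 0) : w = 0 := by
  obtain ⟨hL, hLinj⟩ := contDiff_chartMap h j
  have hfoldall := h.2.2.2.2.2.2.2 j
  obtain ⟨v, hv, hker, hfold⟩ := hfoldall u hu
  have hG : ContDiff ℝ ∞ (proj5 ∘ ι ∘ e j) := by
    rw [← coe_proj5L]
    exact proj5L.contDiff.comp hL
  have hline : ∀ w', fderiv ℝ (proj5 ∘ ι ∘ e j) u w' = 0 → ∃ c : ℝ, w' = c • v :=
    exists_eq_smul_of_fderiv_shadow_eq_zero (hL.differentiable (by simp) u) (hLinj u) hv hker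
  have hsing : ∀ w' : EuclideanSpace ℝ (Fin 4), ‖w'‖ = ‖u‖ →
      ∃ k' : EuclideanSpace ℝ (Fin 4), k' ≠ 0 ∧ fderiv ℝ (proj5 ∘ ι ∘ e j) w' k' = 0 := by
    intro w' hw'
    obtain ⟨v', hv', hker', -⟩ := hfoldall w' (norm_eq_of_mem_pleatSpheres hu hw')
    exact ⟨v', hv', hker'⟩
  have huv : ⟪u, v⟫ ≠ 0 :=
    inner_ne_zero_of_isFoldPoint hG (ne_zero_of_mem_pleatSpheres hu) hv hfold hline hsing
  obtain ⟨c, rfl⟩ := hline w hw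
  rw [real_inner_smul_right] at huw
  rcases mul_eq_zero.1 huw with hc | hc
  · rw [hc, zero_smul]
  · exact absurd hc huv

end Creases

end Summit.SmoothPoincare4.SmoothPoincare4.Theorems.OrigamiFoldExistence.ShadowPleats

end
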